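import Summits.QuantumFields.YangMills.Theorems.AllWindowsColdBoxBoxHighWindowsSU22LineDefs
import Literature.Probability.LatticeModels.DirichletGreenFunction

/-!
# T-S5 STEP 2 — kernel bricks for the second-order expansion (task statements, planner ym-idea-2 g18)

Bricks of `STUB-PLAN-S5-STEP2.md` (crux dir `Cruxes/BoxHighWindowsSU22/`) that do NOT depend on the chart conventions of the expansion and can be
proved now, by name, `--supports stmt-QuantumFields-24004`:

* **T-S5.8a `CubeShellSums`** — single lattice sums over the cube `[0,N]⁴` against the sup-distance weight `(1 + d(p,x))⁻ᵃ` in the convention of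
  ✓S3b `LandauKernelDecay`: `a = 2 ↦ C·N²`, `a = 4 ↦ C·(1 + log N)`, `a = 5 ↦ C` — uniformly in the centre `x ∈ ℤ⁴` (shell counting; the cases
  `a ≤ 3` are the tree's `Literature…Beta.PoissonInterior.sum_cube_inv_nrm_pow_le`, the log case and the summable case are new but by the same count).
* **T-S5.8b `CubeTwoCentreSums`** — the two-centre convolution bounds every first/second-order diagram of STEP 2 is reduced to:
  `(2,2) ↦ C(1+log N)`, `(2,4) ↦ C(1+log N)/(1+d(x,y))²`, `(4,4) ↦ C(1+log N)/(1+d(x,y))⁴` (from 8a by `(1+d(x,y)) ≤ (1+d(p,x)) + (1+d(p,y))`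
  and Cauchy–Schwarz; see the plan §5 for the derivation).
* **T-S5.9 `GhostKernelDecay`** — pointwise Coulomb decay of the ghost propagator `(dirichletMatrix (interiorSites H))⁻¹` (the inverse of
  `−fpOperator H 1` modulo `⊗ pauliPerm`, ✓`fpOperator_one`): `0 ≤ G_Δ(x,y) ≤ C/(1 + d(x,y))²`.  Nearly in the tree: `dirichletGreen_of_mem`,
  `dirichletGreen_nonneg`, `LatticeDirichletEnergy.dirichletGreen_le_half_latticeGreen` (`G_Λ ≤ G_free`, d ≥ 3) and
  `…Beta.PoissonInterior.G₀_bound` (`|latticeGreen v/2| ≤ C₀/nrm(v)²` in `d = 4`), plus `nrm v ≥ (1 + supNorm v)/2`.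

Nothing here is a crux or a rung; these are M/S-sized support lemmas.  HONEST LABEL: task statements only (Props + two defs); S5
(`stub_landauSecondOrder`), ⟨stmt-QuantumFields-24004⟩ ⟨24335⟩ ⟨24336⟩ remain OPEN; route AllWindowsColdBox is DRAFT; the Yang–Mills mass gap is NOT
proved by this file.
-/

set_option autoImplicit false

noncomputable section

open Real Finset
open Literature.Probability.LatticeModels (Site dirichletMatrix)

namespace Summit.QuantumFields.YangMills.Theorems.AllWindowsColdBoxBoxHighLine

/-- Sup-distance of two sites of `ℤ⁴` as a real number — the convention of ✓S3b `LandauKernelDecay`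
(`⨆ k, |x k − y k|`). -/
def siteDist (x y : Site 4) : ℝ := ⨆ k : Fin 4, |((x k - y k : ℤ) : ℝ)|

/-- The sites of the cube `[0,N]⁴`. -/
def cubeSites (N : ℕ) : Finset (Site 4) := Fintype.piFinset fun _ => Finset.Icc (0 : ℤ) N

/-- **T-S5.8a — single shell sums in the cube**, uniformly in the centre `x ∈ ℤ⁴`:
`Σ_{p ∈ [0,N]⁴} (1+d(p,x))⁻² ≤ C N²`, `Σ (1+d(p,x))⁻⁴ ≤ C (1 + log N)`, `Σ (1+d(p,x))⁻⁵ ≤ C` (`N ≥ 1`). -/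
def CubeShellSums : Prop :=
  ∃ C : ℝ, ∀ N : ℕ, 1 ≤ N → ∀ x : Site 4,
    (∑ p ∈ cubeSites N, 1 / (1 + siteDist p x) ^ 2 ≤ C * (N : ℝ) ^ 2) ∧
    (∑ p ∈ cubeSites N, 1 / (1 + siteDist p x) ^ 4 ≤ C * (1 + Real.log N)) ∧
    (∑ p ∈ cubeSites N, 1 / (1 + siteDist p x) ^ 5 ≤ C)

/-- **T-S5.8b — two-centre convolution sums in the cube**, uniformly in the centres `x y ∈ ℤ⁴` (`N ≥ 1`):
`Σ_p (1+d(p,x))⁻²(1+d(p,y))⁻² ≤ C(1+log N)`, `Σ_p (1+d(p,x))⁻²(1+d(p,y))⁻⁴ ≤ C(1+log N)/(1+d(x,y))²`,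
`Σ_p (1+d(p,x))⁻⁴(1+d(p,y))⁻⁴ ≤ C(1+log N)/(1+d(x,y))⁴`. -/
def CubeTwoCentreSums : Prop :=
  ∃ C : ℝ, ∀ N : ℕ, 1 ≤ N → ∀ x y : Site 4,
    (∑ p ∈ cubeSites N, 1 / ((1 + siteDist p x) ^ 2 * (1 + siteDist p y) ^ 2) ≤ C * (1 + Real.log N)) ∧
    (∑ p ∈ cubeSites N, 1 / ((1 + siteDist p x) ^ 2 * (1 + siteDist p y) ^ 4) ≤ C * (1 + Real.log N) / (1 + siteDist x y) ^ 2) ∧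
    (∑ p ∈ cubeSites N, 1 / ((1 + siteDist p x) ^ 4 * (1 + siteDist p y) ^ 4) ≤ C * (1 + Real.log N) / (1 + siteDist x y) ^ 4)

/-- **T-S5.9 — Coulomb decay of the ghost propagator** `G_Δ = (dirichletMatrix (interiorSites H))⁻¹` (the Dirichlet Green function of the
interior sites, `= −(fpOperator H 1)⁻¹` modulo `⊗ pauliPerm⁻¹` by ✓`fpOperator_one`): `0 ≤ G_Δ(x,y) ≤ C/(1 + d(x,y))²`, uniformly in `H`. -/
def GhostKernelDecay : Prop :=
  ∃ C : ℝ, ∀ H : ℕ, 1 ≤ H → ∀ x y : ↥(interiorSites H),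
    0 ≤ (dirichletMatrix (interiorSites H))⁻¹ x y ∧
      (dirichletMatrix (interiorSites H))⁻¹ x y ≤ C / (1 + siteDist (x : Site 4) (y : Site 4)) ^ 2

/-! Sanity: the three Props elaborate and are not closed by the cheap batteries (they are genuine estimates). -/
example : CubeShellSums → CubeTwoCentreSums → GhostKernelDecay → True := fun _ _ _ => trivial

end Summit.QuantumFields.YangMills.Theorems.AllWindowsColdBoxBoxHighLine

end
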